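import Literature.MathematicalPhysics.QuantumFieldTheory.Balaban1983to89.B13Lemma1BlocksTorus
import Literature.MathematicalPhysics.QuantumFieldTheory.Balaban1983to89.B13LeafTorus

/-!
# `Balaban1983to89.B13Lemma1BlocksTorusNonvacuity` — T. Bałaban, *Renormalization group approach to lattice gauge field
theories. II. Cluster expansions*, Commun. Math. Phys. **116** (1988) 1–22 [Balaban1988RG2Cluster]: **NON-VACUITY of the
numerical restrictions under which Lemma 1 with [I]'s block geometry (`B13Lemma1BlocksTorus.lemma1Printed_twoTorus_blocks`)
and the B13 leaf knit (`B13LeafTorus.b13Leaf_twoTorus`, (1.43) by one-shot absorption) were landed on the two-scale torus**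

statement-level skeleton of published theorems with citation tags; proofs where landed; nothing here is a claim about
the Yang–Mills mass gap

CITATION HEADER / WHAT IS REPRODUCED (cell `pub-ymgap`, Track A node N10 = [B13], prover seat `pub-ymgap-dag-p2`,
thirteenth module; a NEW LEAF, nothing modified).  p. 21, verbatim: *"The assumptions allow finally us to fix all the
constants, or rather bounds on these constants."*  The torus theorems of this seat carry the printed «sufficiently
large» clauses of pp. 7–9 as explicit real-number thresholds (κ, δκ ≥ κ₀(64, 8); κ₁ ≥ 1 + 2 log(8·12³), ≥ 2 + 16 log 128;
δ₀M ≥ 10e⁻¹, ≥ 2 log 5; δκ ≥ 1; R8 (1 − δ)κ ≤ ¼(κ₁ − 1); R9 (1 − 2δ)κ ≤ (1/16)κ₁; the one-shot floor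
27/2·C₁e^{49κ₁−1} ≤ e^{C₂κ₁}; the constant inequality of (1.36)).  `blocks_leaf_nonvacuous` exhibits ONE assignment
(L = 12, N′ = 1, q = 0, M = 10, κ = 20000, κ₁ = 10⁶, δ = 99/100, δ₀ = 1, C₂ = 50, all other constants 1; the
all-zero step datum with M⁻⁴|Y| := #Y, empty index families and K = K′ = 0) at which EVERY numerical hypothesis holds — listed as
explicit conjuncts — and through which `lemma1Printed_twoTorus_blocks` and `b13Leaf_twoTorus` are APPLIED (the proof
term discharges each of their hypotheses at the witness), so the hypothesis lists are jointly satisfiable.  As for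
`B13Lemma3TorusNonvacuity`: the witness says nothing about the size of the physical constants and the all-zero datum
carries no analysis; it certifies only that the inequalities AS TYPED are consistent (κ₀(64, 8) = 64 log 162 ≤ 64·162).
The Lemma-3 numerics (`bound238_torus`) have their own witness (`B13Lemma3TorusNonvacuity`, C₂ = 1 there, which the
one-shot floor excludes — a JOINT witness for `B13NodeTorus.b13_main_twoTorus_located` is not claimed here).
HONEST FRAMING: a count-neutral Track-A side landing (YM-PLAN §1); NOT a discharge of node N10; nothing continuum /
OS / mass-gap / Clay.
-/

noncomputable section

namespace Literature.MathematicalPhysics.QuantumFieldTheory.Balaban1983to89.B13Lemma1BlocksTorusNonvacuity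

open Literature.MathematicalPhysics.QuantumFieldTheory.Balaban1983to89
open Literature.MathematicalPhysics.QuantumFieldTheory.Balaban1983to89.B13ScaleTransfer (Pt)
open Literature.MathematicalPhysics.QuantumFieldTheory.Balaban1983to89.B16Absorption (pbox)
open Literature.MathematicalPhysics.QuantumFieldTheory.Balaban1983to89.TreeLengthTorus
open Literature.MathematicalPhysics.QuantumFieldTheory.Balaban1983to89.TreeLengthTorusTransfer (tcoarse)
open Literature.MathematicalPhysics.QuantumFieldTheory.Balaban1983to89.B12TreeDecay (kappa₀ K₀ K₀_pos a₀)
open Literature.MathematicalPhysics.QuantumFieldTheory.Balaban1983to89.B13Lemma3Torus (TwoTorusStep lemma3Printed_torus)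
open Literature.MathematicalPhysics.QuantumFieldTheory.Balaban1983to89.B13CubeSumTorus (image_pbox_eq_univ)
open Literature.MathematicalPhysics.QuantumFieldTheory.Balaban1983to89.B13Lemma1BlocksTorus (lemma1Printed_twoTorus_blocks)
open Literature.MathematicalPhysics.QuantumFieldTheory.Balaban1983to89.B13LeafTorus (b13Leaf_twoTorus)

/-- κ₀(64, 8) = 64·log(2·9²) ≤ 64·162 (log x ≤ x − 1).  Private numeric plumbing. [folklore] -/
private theorem kappa₀_64_8_le : kappa₀ 64 8 ≤ 64 * 162 := by
  unfold kappa₀ a₀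
  have h : Real.log (2 * ((8 : ℕ) + 1 : ℝ) ^ 2) ≤ 162 := by
    have := Real.log_le_sub_one_of_pos (show (0:ℝ) < 2 * ((8 : ℕ) + 1 : ℝ) ^ 2 by positivity)
    norm_num at this ⊢; linarith
  nlinarith

/-- **NON-VACUITY OF THE NUMERICAL RESTRICTIONS OF THE TORUS LEMMA-1 ∕ LEAF THEOREMS.**  There are constants
`c : B13.Consts` and a two-scale torus step datum `W : TwoTorusStep 4 12 1` at which every numerical hypothesis of
`B13Lemma1BlocksTorus.lemma1Printed_twoTorus_blocks` and of `B13LeafTorus.b13Leaf_of_lemmas_oneShot` holds (the listed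
conjuncts) and at which those theorems apply (the last conjunct is OBTAINED THROUGH them: all-zero datum, empty index
families, K = K′ = 0, (2.38) trivially).  p. 21: *"The assumptions allow finally us to fix all the constants, or rather
bounds on these constants."* [cite: Balaban1988RG2Cluster, p.21 (closing paragraph: the constants can be fixed)] -/
theorem blocks_leaf_nonvacuous : ∃ (c : B13.Consts) (W : TwoTorusStep 4 12 1),
    12 ≤ 12 * 1 ∧ c.L = 12 ∧ kappa₀ 64 8 ≤ c.κ ∧ kappa₀ 64 8 ≤ c.δ * c.κ ∧ 0 ≤ c.κ ∧ c.δ < 1 ∧ 1 ≤ c.δ * c.κ ∧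
    0 ≤ c.δ₀ ∧ 1 + 2 * Real.log (8 * 12 ^ 3) ≤ c.κ₁ ∧ 2 + 16 * Real.log 128 ≤ c.κ₁ ∧
    10 * Real.exp (-1) ≤ c.δ₀ * c.M ∧ 2 * Real.log 5 ≤ c.δ₀ * c.M ∧
    (1 - c.δ) * c.κ ≤ (1 / 4) * (c.κ₁ - 1) ∧ (1 - 2 * c.δ) * c.κ ≤ (1 / 16) * c.κ₁ ∧
    27 / 2 * c.C₁ * Real.exp (49 * c.κ₁ - 1) ≤ Real.exp (c.C₂ * c.κ₁) ∧ 0 ≤ c.ε₁ ∧ 0 ≤ c.C₃ ∧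
    0 < c.E₀ * c.ε₁ * c.C₁ * c.M ^ c.q * Real.exp (c.C₂ * c.κ₁) ∧
    (B13.Lemma1Printed W.toStepData c ∧ B13.Lemma2Printed W.toStepData c ∧ B13.Lemma3Printed W.toStepData c) := by
  -- the witness constants
  let c : B13.Consts :=
    { L := 12, q := 0, M := 10, κ := 20000, κ₁ := 1000000, δ := 99 / 100, δ₀ := 1, E₀ := 1, ε₁ := 1, C₁ := 1,
      C₂ := 50, C₃ := 1, α₀ := 1, α₁ := 1, α₄ := 1, α₅ := 1, α₆ := 1, γ₂ := 1, γ := 1, A₁ := 1, A₂ := 1 }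
  -- the all-zero two-scale torus step datum on the torus with 12 cubes of π_k per direction
  let W : TwoTorusStep 4 12 1 :=
    { volk := fun Y => Y.1.card, Φ := Unit, Bond := Unit, sp1 := fun _ => Set.univ, sp2 := fun _ => Set.univ,
      Bv := fun _ _ => 0, Vp := fun _ _ => 0, V := fun _ _ => 0, Q := fun _ _ _ _ => 0, Vpp := fun _ _ => 0,
      H := fun _ _ => 0, Ek1 := fun _ _ => 0, Elog := fun _ _ => 0, Analytic := fun _ _ => True,
      GaugeInv := fun _ => True, Repr17 := True, Restr := True }
  have hκ₀ := kappa₀_64_8_le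
  have hlog1 : Real.log (8 * 12 ^ 3) ≤ 13824 := by
    have := Real.log_le_sub_one_of_pos (show (0:ℝ) < 8 * 12 ^ 3 by norm_num); norm_num at this ⊢; linarith
  have hlog2 : Real.log 128 ≤ 128 := by
    have := Real.log_le_sub_one_of_pos (show (0:ℝ) < 128 by norm_num); linarith
  have hlog5 : Real.log 5 ≤ 5 := by
    have := Real.log_le_sub_one_of_pos (show (0:ℝ) < 5 by norm_num); linarith
  have hexp1 : Real.exp (-1) ≤ 1 := Real.exp_le_one_iff.mpr (by norm_num)
  have hfloor : 27 / 2 * c.C₁ * Real.exp (49 * c.κ₁ - 1) ≤ Real.exp (c.C₂ * c.κ₁) := by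
    show 27 / 2 * (1 : ℝ) * Real.exp (49 * 1000000 - 1) ≤ Real.exp (50 * 1000000)
    have h1 : (27 : ℝ) / 2 ≤ Real.exp (1000000 + 1) := by
      have := Real.add_one_le_exp (1000000 + 1 : ℝ); norm_num at this ⊢; linarith
    calc 27 / 2 * (1 : ℝ) * Real.exp (49 * 1000000 - 1) ≤ Real.exp (1000000 + 1) * Real.exp (49 * 1000000 - 1) := by
          rw [mul_one]; exact mul_le_mul_of_nonneg_right h1 (Real.exp_pos _).le
      _ = Real.exp (50 * 1000000) := by rw [← Real.exp_add]; norm_num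
  -- numeric thresholds at c
  have hN12 : 12 ≤ 12 * 1 := le_rfl
  have hκ : (0 : ℝ) ≤ c.κ := by show (0:ℝ) ≤ 20000; norm_num
  have hδ1 : c.δ < 1 := by show (99 : ℝ) / 100 < 1; norm_num
  have hδκ : 1 ≤ c.δ * c.κ := by show (1 : ℝ) ≤ 99 / 100 * 20000; norm_num
  have hδ₀ : (0 : ℝ) ≤ c.δ₀ := by show (0:ℝ) ≤ 1; norm_num
  have hκ126 : kappa₀ 64 8 ≤ c.κ := by show kappa₀ 64 8 ≤ 20000; linarith
  have hκ126' : kappa₀ 64 8 ≤ c.δ * c.κ := by show kappa₀ 64 8 ≤ 99 / 100 * 20000; linarith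
  have hκ₁ : 1 + 2 * Real.log (8 * 12 ^ 3) ≤ c.κ₁ := by show 1 + 2 * Real.log (8 * 12 ^ 3) ≤ 1000000; linarith
  have hκ₁' : 2 + 16 * Real.log 128 ≤ c.κ₁ := by show 2 + 16 * Real.log 128 ≤ 1000000; linarith
  have hδ₀M : 10 * Real.exp (-1) ≤ c.δ₀ * c.M := by show 10 * Real.exp (-1) ≤ 1 * 10; linarith
  have hδ₀M5 : 2 * Real.log 5 ≤ c.δ₀ * c.M := by show 2 * Real.log 5 ≤ 1 * 10; linarith
  have hR8 : (1 - c.δ) * c.κ ≤ (1 / 4) * (c.κ₁ - 1) := by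
    show (1 - (99 : ℝ) / 100) * 20000 ≤ (1 / 4) * (1000000 - 1); norm_num
  have hR9 : (1 - 2 * c.δ) * c.κ ≤ (1 / 16) * c.κ₁ := by
    show (1 - 2 * ((99 : ℝ) / 100)) * 20000 ≤ (1 / 16) * 1000000; norm_num
  have hε₁ : (0 : ℝ) ≤ c.ε₁ := by show (0:ℝ) ≤ 1; norm_num
  have hC₃ : (0 : ℝ) ≤ c.C₃ := by show (0:ℝ) ≤ 1; norm_num
  have hRHS : 0 < c.E₀ * c.ε₁ * c.C₁ * c.M ^ c.q * Real.exp (c.C₂ * c.κ₁) := by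
    show (0 : ℝ) < 1 * 1 * 1 * 10 ^ (0 : ℕ) * Real.exp (50 * 1000000); positivity
  -- Lemma 1 through `lemma1Printed_twoTorus_blocks` (k = 0, empty families, K = K′ = 0, dist ≡ 40)
  have h1 : B13.Lemma1Printed W.toStepData c := by
    refine lemma1Printed_twoTorus_blocks W c 0 hN12 (fun _ => ∅) (fun _ _ => ∅) (fun _ _ _ => ∅)
      (fun _ _ _ _ => ∅) (fun _ _ _ _ _ _ _ => 0) (fun _ => ∅) (fun _ _ _ => ∅) (fun _ _ _ _ => ∅)
      (fun _ _ _ _ _ _ => 0) (fun _ _ _ _ => 40) (K := 0) (K' := 0) ?_ ?_ ?_ ?_ ?_ ?_ ?_ ?_ ?_ ?_ ?_ ?_ ?_ ?_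
      le_rfl le_rfl (by norm_num) hκ hδ1 hδκ hκ126 hκ126' hκ₁ hκ₁' hδ₀M hδ₀M5 hR8 hR9 ?_ ?_ ?_
    · intro Y; simp only [Finset.sum_empty, add_zero]; rfl
    · intro Y a ha; simp at ha
    · intro Y a; exact Finset.empty_subset _
    · intro Y a ha; simp at ha
    · intro Y; exact Finset.empty_subset _
    · intro Y a j q; show (0 : ℝ) ≤ 1 * 40; norm_num
    · intro Y a j n q hq
      show (1 : ℝ) * 10 * ((n : ℝ) + 1) ≤ 1 * 40
      rcases le_or_gt n 3 with hn | hn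
      · have : (n : ℝ) ≤ 3 := by exact_mod_cast hn
        linarith
      · exfalso
        apply hq
        have hcover := image_pbox_eq_univ (12 ^ (0 - j) * (12 * 1))
          (lo := fun i => ((12 ^ (0 - j) : ℕ) : ℤ) * natLift a i - (n + 1 : ℕ))
          (hi := fun i => ((12 ^ (0 - j) : ℕ) : ℤ) * natLift a i + 2 * ((12 ^ (0 - j) : ℕ) : ℤ) - 1 + (n + 1 : ℕ))
          (fun i => by push_cast; simp; omega)
        rw [hcover]
        exact Finset.mem_univ _
    · intro Y a j q; exact Finset.empty_subset _
    · intro Y a j q; exact Finset.empty_subset _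
    · intro Y a ha; simp at ha
    · intro s f g _ _; trivial
    · intro s; trivial
    · intro Y a ha; simp at ha
    · intro Y a ha; simp at ha
    · intro Y φ _ a ha; simp at ha
    · intro Y φ _ a ha; simp at ha
    · show (0 : ℝ) * K₀ 64 8 * (2 * (6 * ((12 : ℕ) : ℝ)) ^ 4) * Real.exp 1 * Real.exp ((1 / 8) * c.κ₁ * (12 ^ 4 - 1)) +
          2 * (64 * 0) * K₀ 64 8 * 1344 ≤ c.E₀ * c.ε₁ * c.C₁ * c.M ^ c.q * Real.exp (c.C₂ * c.κ₁)
      have := hRHS.le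
      simpa using this
  -- Lemma 2 inputs and (2.38) at the all-zero datum
  have hVpp : W.Vpp = W.Vp := rfl
  have hQ0 : ∀ Y φ b b', W.toStepData.Q Y φ b b' = 0 := fun _ _ _ _ => rfl
  have hrepr : B13.Repr142 W.toStepData := by
    intro Y φ _
    show (0 : ℂ) = W.toStepData.quadForm Y φ + 0
    simp [B13.StepData.quadForm, hQ0]
  have hQ : B13.Bound143 W.toStepData c := by
    refine B13Bound143.bound143_of_oneShot W.toStepData c hε₁ hC₃ hfloor fun Y φ b b' _ => ?_
    show ‖(0 : ℂ)‖ ≤ _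
    rw [norm_zero]
    refine mul_nonneg ?_ (Real.exp_pos _).le
    show (0 : ℝ) ≤ 27 / 2 * 1 * Real.exp (49 * 1000000 - 1) * 10 ^ 4 * (1 * 1)
    positivity
  have hVan : ∀ Y, W.Analytic (W.V Y) (W.sp1 Y) := fun _ => trivial
  have hG : ∀ Y, W.GaugeInv (W.V Y) ∧ W.GaugeInv (W.toStepData.quadForm Y) ∧ W.GaugeInv (W.Vpp Y) :=
    fun _ => ⟨trivial, trivial, trivial⟩
  have h238 : B13.Bound238 W.toStepData c := by
    intro Z φ _
    show ‖(0 : ℂ)‖ ≤ _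
    rw [norm_zero]
    have hC3 : 0 ≤ c.C3act * c.ε₁ := by
      show (0 : ℝ) ≤ B13.Consts.C3act c * 1
      unfold B13.Consts.C3act B13.Consts.K₀
      show (0:ℝ) ≤ 2 * (((12 : ℕ) : ℝ) + 2) ^ 4 * 1 * (1 * (2 * 1 * (1:ℝ)⁻¹ * (1:ℝ)⁻¹ * 10 ^ (0:ℕ) *
        Real.exp (50 * 1000000))) * 1
      positivity
    exact mul_nonneg hC3 (Real.exp_pos _).le
  exact ⟨c, W, hN12, rfl, hκ126, hκ126', hκ, hδ1, hδκ, hδ₀, hκ₁, hκ₁', hδ₀M, hδ₀M5, hR8, hR9, hfloor, hε₁, hC₃, hRHS,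
    b13Leaf_twoTorus W c h1 hVpp hrepr hQ hVan hG h238⟩

end Literature.MathematicalPhysics.QuantumFieldTheory.Balaban1983to89.B13Lemma1BlocksTorusNonvacuity
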